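import Literature.IUT.HodgeTheaters.PuncturedEllipticCoveringsCor12L3OfGeomOriginIota
import Literature.IUT.HodgeTheaters.PuncturedEllipticProLModelLabels
import Literature.IUT.HodgeTheaters.PuncturedEllipticCoveringsCor12OfGeomOriginEx48CuspGalois
import Literature.IUT.HodgeTheaters.InitialThetaDataCor12Derived
import HarnessLib

/-!
# [IUTchI] Cor. 1.2 at the genuine `K`-level data — closer «cor12_v16»: ALL six printed `Δ_ε`-laws AND the GAP binder
# `h0` DISCHARGED over the origin records `GeomOriginIota` + the cusp action — LAW = 0, GAP = 0 (proof-only knit)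

Mochizuki, *Inter-universal Teichmüller theory I: construction of Hodge theaters*, kurims manuscript (May 2020), §1 pp. 37–39,
Corollary 1.2 and its proof p. 39 l. 19–46 («the decomposition groups of `ε⁰`, `ε′`, `ε″` […] may be recovered as the
decomposition groups of cusps […] whose image in `Gal(X̲→/X̲)` is nontrivial») [cite: Mochizuki2012, IUTchI Cor 1.2 p.39]
(D-0012 claim key; series status DISPUTED — nothing of the series is asserted here).

PROOF-ONLY knit (cell abc-iut, seat abc-iut-w6-d032 gen 8; abc-iut-L5-lead L5 ROWS #7 rows R45/R46/R48/R49, «R48: whoever lands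
last knits»; no `def`, no instance, no notation, no new `Prop` fact; nothing restated), EVERYTHING BY NAME over the landings of
2026-08-27 04–07Z:
* (L2a)(L2c) ⟸ abc-iut-L5-d4 `PuncturedEllipticProLModelLabels.lean` (`GeomOrigin.inertia_ε1_image_order_of_cuspGalois`,
  `GeomOrigin.inertia_images_inf_le_of_cuspGalois`: from (A)(c′) + the cusp action + `l` prime + `[Π_X : Π_X̲] = l`, read off the
  pro-`l` shadow; the cusp-separation law (I) is itself a theorem there, `GeomOrigin.inertia_conj_injective`);
* (L3) ⟸ abc-iut-L5-t1 `…Cor12L3OfGeomOriginIota.lean` (p508782: `GeomOriginIota.iota_neg`, over `…Cor12IotaNegOfOrigin` p502003,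
  `…Cor12CuspSpanOfRelation` p506512 and abc-iut-w6-d032's transfer theorem `GeomOrigin.inertia_ε0_le_span`, p506921);
* (L0)(L1)(L4) ⟸ abc-iut-w4-d051 `…Cor12InertiaCentralOfCuspGalois.lean` (p501910: `GeomOrigin.modLCuspLaws_of_labels`, over
  abc-iut-L5-t1 p500241 and abc-iut-f-090);
* the GAP binder `h0` (G-L5d4g6-1) ⟸ abc-iut-w6-d032 `…Eps0RamificationOfOrientedInertia.lean` (p499258: `h0` ⟸ (O1) + (O2) +
  `ModLCuspLaws`) with (O1) := `GeomOrigin.exists_orientedProduct` (p506921, the transfer `Δ_X → Δ_X̲^{ab}`) and (O2) :=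
  `GeomOriginIota.inertia_ε0_conj_mem_modLKer` (p508782, one call of abc-iut-w6-d032's p503354 «`χ(ι) = det(−1) = +1`»);
* the Cor. 1.2 composition «cor12_v14» abc-iut-L5-t1 `…Cor12OfGeomOriginEx48CuspGalois.lean` (p502506) over abc-iut-w6-d032 «v12»
  (p496734), abc-iut-L5-t1 «v11» (p496323), abc-iut-f-090, abc-iut-L4 (`EllipticModel`, `Ex_4_8_i`, `Cor_3_3_i`);
* `l` prime and `[Π_{X_K} : Π_{X̲_K}] = l` at an initial Θ-datum: [IUTchI] Def. 3.1 (c)(d) (`InitialThetaData.l_prime`,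
  `ThetaGeometry.pe_l`, `InitialThetaData.pe_relIndex_piXbar_piX`).

WHAT THIS FILE PROVES, by name:
* `GeomOriginIota.modLCuspLaws (O) (C) (hl) (hX) : D.ModLCuspLaws` — abc-iut-L5-t1's whole record of the six `Δ_ε`-level laws of
  [IUTchI] §1 pp. 37–38 as a THEOREM of the origin record with involution, the cusp action, the field (∗), `l` prime and
  `[Π_X : Π_X̲] = l`;
* `GeomOriginIota.not_inertia_ε0_le_piXarrow (O) (C) (hL) (hι)` / `…_of_index (O) (C) (hl) (hX) (hι)` — the GAP binder `h0`
  «`ε⁰` is ramified in `X̲→ → X̲`» as a THEOREM (given a geometric representative of `Gal(X̲/C̲)`);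
* `InitialThetaData.pe_modLCuspLaws_of_geomOriginIota (O) (C)`, `InitialThetaData.pe_not_inertia_ε0_le_piXarrow_of_geomOriginIota
  (O) (C)` — the same at an initial Θ-datum, NO further binder;
* **`InitialThetaData.pe_characteristicNatureOfCoverings_of_geomOriginIota_ex48`** — [IUTchI] Cor. 1.2 between the `K`-level data
  of two initial Θ-data, «cor12_v16»: TELESCOPE = DATA `C C′` (cusp actions) `A` ([AbsTopI] Lem. 4.5 (v) algorithm) `O O′` (origin
  records WITH involution) + model/member/realisation data (`h𝒟 hEx M h33`, members, homeomorphic realisations) · FACT-INSTANCE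
  `hEx` (F-0193) `h33` (F-0294) `hA hA′` (F-0206) · **LAW = ∅ · GAP = ∅** — no printed `Δ_ε` sentence, no GAP-LEDGER binder, no
  orientation binder, no cusp-separation law is displayed any more.
CENSUS EFFECT (abc-iut-L5-lead RULINGS #125 (3) FLIP CONDITION for `IUTchI:Cor1.2`): displayed LAW = 0 and GAP = 0; every
remaining binder is DATA / FACT-INSTANCE (F-0193, F-0294, F-0206 by name) / ORIGIN record (`GeomOriginIota` = (A)(c′)(e)(i),
INHABITED at abc-iut-L4-t15's profinite model with involution, p500947 / p502197, labelled) / the [AbsTopI] Ex. 4.8 class shape.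

HONEST FRAMING: a by-name composition of landed theorems; origin records and model/member/realisation data are assumption-shaped
binders asserted for no instance; typed ≠ discharged for F-0193/F-0294/F-0206 (FACT policy); nothing here bears on
[IUTchIII] Cor. 3.12 or asserts that abc is proved or refuted; no printed statement is strengthened.
-/

noncomputable section

open CategoryTheory Topology

namespace Literature.IUT.HodgeTheaters

namespace PuncturedEllipticData

open scoped Pointwise
open Literature.AnabelianGeometry.AbsoluteAnabelian

universe u

variable {D : PuncturedEllipticData.{u}}

/-! ### §1. The six `Δ_ε`-level laws and the GAP binder `h0` over `GeomOriginIota` -/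

/-- **abc-iut-L5-t1's record `ModLCuspLaws` — the six `Δ_ε`-level laws (L0)(L1)(L2a)(L2c)(L3)(L4) of [IUTchI] §1 pp. 37–38 — is a
THEOREM** of the origin record with involution `O : D.GeomOriginIota`, the cusp action `C`, the field (∗), `l` prime and
`[Π_X : Π_X̲] = l` ((L2a)(L2c): abc-iut-L5-d4; (L3): abc-iut-L5-t1 over this seat's transfer theorem; (L0)(L1)(L4): abc-iut-w4-d051 /
abc-iut-L5-t1 / abc-iut-f-090). ([IUTchI] §1 pp.37–38) [claim: Mochizuki2012, status: disputed] -/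
theorem GeomOriginIota.modLCuspLaws (O : D.GeomOriginIota) (C : D.CuspGalois) (hl : D.l.Prime)
    (hX : D.PiXbar.relIndex D.PiX = D.l) : D.ModLCuspLaws :=
  O.toGeomOrigin.modLCuspLaws_of_labels C (O.toGeomOrigin.inertia_ε1_image_order_of_cuspGalois C hl hX)
    (O.toGeomOrigin.inertia_images_inf_le_of_cuspGalois C hl hX) (O.iota_neg C)

/-- **The GAP binder `h0` (G-L5d4g6-1) as a THEOREM over `GeomOriginIota` + `ModLCuspLaws`**: for an origin record with
involution, the cusp action, the six `Δ_ε`-level laws and a geometric representative of `Gal(X̲/C̲)`, the zero cusp `ε⁰` is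
RAMIFIED in `X̲→ → X̲`: `¬ I_{ε⁰} ⊆ Π_{X̲→}` — p499258's `not_inertia_ε0_le_piXarrow_of_orientedInertia` with (O1) :=
`GeomOrigin.exists_orientedProduct` (p506921, the transfer) and (O2) := `GeomOriginIota.inertia_ε0_conj_mem_modLKer` (p508782 ∘
p503354). ([IUTchI] Cor 1.2 p.39) [claim: Mochizuki2012, status: disputed] -/
theorem GeomOriginIota.not_inertia_ε0_le_piXarrow (O : D.GeomOriginIota) (C : D.CuspGalois) (hL : D.ModLCuspLaws)
    (hι : ∃ c ∈ D.DeltaCbar, c ∉ D.DeltaXbar) : ¬ D.inertia D.ε0 ≤ D.piXarrow :=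
  C.not_inertia_ε0_le_piXarrow_of_orientedInertia hL hι (O.toGeomOrigin.exists_orientedProduct C)
    (O.inertia_ε0_conj_mem_modLKer C)

/-- **`h0` over `GeomOriginIota` with `l` prime and `[Π_X : Π_X̲] = l`** (the laws being `GeomOriginIota.modLCuspLaws`).
([IUTchI] Cor 1.2 p.39) [claim: Mochizuki2012, status: disputed] -/
theorem GeomOriginIota.not_inertia_ε0_le_piXarrow_of_index (O : D.GeomOriginIota) (C : D.CuspGalois) (hl : D.l.Prime)
    (hX : D.PiXbar.relIndex D.PiX = D.l) (hι : ∃ c ∈ D.DeltaCbar, c ∉ D.DeltaXbar) :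
    ¬ D.inertia D.ε0 ≤ D.piXarrow :=
  O.not_inertia_ε0_le_piXarrow C (O.modLCuspLaws C hl hX) hι

end PuncturedEllipticData

/-! ### §2. At an initial Θ-datum ([IUTchI] Def. 3.1): the laws, `h0`, and the Cor. 1.2 knit «cor12_v16» -/

namespace InitialThetaData

open scoped Pointwise
open Literature.AlgebraicGeometry.Frobenioids (IsSlimGroup)
open Literature.AnabelianGeometry.AbsoluteAnabelian
open Literature.AnabelianGeometry.AbsoluteAnabelian.FundamentalExtension (CuspidalAlgorithm)
open Literature.AnabelianGeometry.AbsoluteAnabelian.AbsTopI (ConstructionDataClass)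
open Literature.AnabelianGeometry.AbsoluteAnabelian.AbsTopII (EllipticModel)

universe u u'

variable {F : Type u} {K : Type} {Fbar : Type} [Field F] [NumberField F] [Field K] [NumberField K]
  [Algebra F K] [Field Fbar] [Algebra F Fbar] [Algebra K Fbar]
  {E : WeierstrassCurve F} [E.IsElliptic] {l : ℕ} {Pb : BadPlacePredicates K}
  (D : InitialThetaData F K Fbar E l Pb)
  {F' : Type u'} {K' : Type} [Field F'] [NumberField F'] [Field K'] [NumberField K'] [Algebra F' K']
  {Fbar' : Type} [Field Fbar'] [Algebra F' Fbar'] [Algebra K' Fbar']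
  {E' : WeierstrassCurve F'} [E'.IsElliptic] {l' : ℕ} {Pb' : BadPlacePredicates K'}
  (D' : InitialThetaData F' K' Fbar' E' l' Pb')

/-- **The six `Δ_ε`-level laws at an initial Θ-datum** from the origin record with involution and the cusp action alone —
`l` prime is Def. 3.1 (c) (`l_prime`), `[Π_{X_K} : Π_{X̲_K}] = l` is Def. 3.1 (d) (`pe_relIndex_piXbar_piX`).
([IUTchI] Def 3.1 p.62, §1 pp.37–38) [claim: Mochizuki2012, status: disputed] -/
theorem pe_modLCuspLaws_of_geomOriginIota (O : D.geom.pe.GeomOriginIota) (C : D.geom.pe.CuspGalois) :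
    D.geom.pe.ModLCuspLaws :=
  O.modLCuspLaws C (by rw [D.geom.pe_l]; exact D.l_prime) D.pe_relIndex_piXbar_piX

/-- **The GAP binder `h0 : ¬ I_{ε⁰} ⊆ Π_{X̲→_K}` of the [IUTchI] Cor. 1.2 closers at an initial Θ-datum is a THEOREM** of the origin
record with involution and the cusp action — the geometric representative of `Gal(X̲_K/C̲_K)` exists by Def. 3.1 (d)
(`ThetaGeometry.not_PiCbar_le_PiX`, `ThetaGeometry.aug_PiXbar`). ([IUTchI] Cor 1.2 p.39) [claim: Mochizuki2012, status: disputed] -/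
theorem pe_not_inertia_ε0_le_piXarrow_of_geomOriginIota (O : D.geom.pe.GeomOriginIota) (C : D.geom.pe.CuspGalois) :
    ¬ D.geom.pe.inertia D.geom.pe.ε0 ≤ D.geom.pe.piXarrow :=
  O.not_inertia_ε0_le_piXarrow C (D.pe_modLCuspLaws_of_geomOriginIota O C)
    (D.geom.pe.exists_mem_deltaCbar_not_mem_deltaXbar D.geom.not_PiCbar_le_PiX D.geom.aug_PiXbar)

/-- **[IUTchI] Cor. 1.2 between the `K`-level data of two initial Θ-data — closer «cor12_v16»**: «cor12_v14» (p502506) over origin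
records WITH involution, with the six printed `Δ_ε` label sentences AND the GAP binders `h0 h0′` ALL DISCHARGED and nothing
added.  TELESCOPE: DATA `C C′ A O O′` + model/member/realisation data · FACT-INSTANCE `hEx` (F-0193) `h33` (F-0294) `hA hA′`
(F-0206) · CLASS SHAPE `h𝒟` · LAW = ∅ · GAP = ∅. ([IUTchI] Cor 1.2 p.39) [claim: Mochizuki2012, status: disputed] -/
theorem pe_characteristicNatureOfCoverings_of_geomOriginIota_ex48
    (O : D.geom.pe.GeomOriginIota) (O' : D'.geom.pe.GeomOriginIota)
    (C : D.geom.pe.CuspGalois) (C' : D'.geom.pe.CuspGalois)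
    -- a class of [AbsTopI] Example 4.8 (i) with its named fact F-0193, a Cor 3.3/3.4 model over it, F-0294 by name
    {𝒟 : ConstructionDataClass.{0}} {p : ℕ} [Fact p.Prime] (h𝒟 : 𝒟.IsEx48ClassGen p) (hEx : 𝒟.Ex_4_8_i p)
    (M : EllipticModel 𝒟) (h33 : M.Cor_3_3_i)
    -- members X, X′ over number fields, realised by Π_{X̲→}, Π′_{X̲→} with k-cores Π_C, Π′_C
    {bX bX' : 𝒟.Base} [NumberField (𝒟.fld bX)] [NumberField (𝒟.fld bX')]
    {X : (𝒟.datum bX).Obj} {X' : (𝒟.datum bX').Obj}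
    (hmemX : 𝒟.Mem bX X) (hadmX : M.IsEllipticallyAdmissible bX X) (hΔX : IsSlimGroup ((𝒟.datum bX).ext X).geom)
    (hneX : ((𝒟.datum bX).ext X).geom ≠ ⊥) (htfgX : ((𝒟.datum bX).ext X).GeomTFG)
    (hmemX' : 𝒟.Mem bX' X') (hadmX' : M.IsEllipticallyAdmissible bX' X') (hΔX' : IsSlimGroup ((𝒟.datum bX').ext X').geom)
    (hneX' : ((𝒟.datum bX').ext X').geom ≠ ⊥) (htfgX' : ((𝒟.datum bX').ext X').GeomTFG)
    (hS : (𝒟.datum bX').primes = (𝒟.datum bX).primes)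
    (ePi : ((𝒟.datum bX).ext X).arith ≃ₜ* D.geom.pe.piXarrow) (eC : (M.coreExt bX X).arith ≃ₜ* D.geom.pe.PiC)
    (hcomp : ∀ x, eC ((M.toCore bX X).arith x) = (ePi x : D.geom.pe.PiC))
    (ePi' : ((𝒟.datum bX').ext X').arith ≃ₜ* D'.geom.pe.piXarrow) (eC' : (M.coreExt bX' X').arith ≃ₜ* D'.geom.pe.PiC)
    (hcomp' : ∀ x, eC' ((M.toCore bX' X').arith x) = (ePi' x : D'.geom.pe.PiC))
    -- members Y, Y′ over number fields, realised by Π_{C̲→}, Π′_{C̲→} with k-cores Π_C, Π′_C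
    {bY bY' : 𝒟.Base} [NumberField (𝒟.fld bY)] [NumberField (𝒟.fld bY')]
    {Y : (𝒟.datum bY).Obj} {Y' : (𝒟.datum bY').Obj}
    (hmemY : 𝒟.Mem bY Y) (hadmY : M.IsEllipticallyAdmissible bY Y) (hΔY : IsSlimGroup ((𝒟.datum bY).ext Y).geom)
    (hneY : ((𝒟.datum bY).ext Y).geom ≠ ⊥) (htfgY : ((𝒟.datum bY).ext Y).GeomTFG)
    (hmemY' : 𝒟.Mem bY' Y') (hadmY' : M.IsEllipticallyAdmissible bY' Y') (hΔY' : IsSlimGroup ((𝒟.datum bY').ext Y').geom)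
    (hneY' : ((𝒟.datum bY').ext Y').geom ≠ ⊥) (htfgY' : ((𝒟.datum bY').ext Y').GeomTFG)
    (hSY : (𝒟.datum bY').primes = (𝒟.datum bY).primes)
    (fPi : ((𝒟.datum bY).ext Y).arith ≃ₜ* D.geom.pe.piCarrow) (fC : (M.coreExt bY Y).arith ≃ₜ* D.geom.pe.PiC)
    (hcompY : ∀ x, fC ((M.toCore bY Y).arith x) = (fPi x : D.geom.pe.PiC))
    (fPi' : ((𝒟.datum bY').ext Y').arith ≃ₜ* D'.geom.pe.piCarrow) (fC' : (M.coreExt bY' Y').arith ≃ₜ* D'.geom.pe.PiC)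
    (hcompY' : ∀ x, fC' ((M.toCore bY' Y').arith x) = (fPi' x : D'.geom.pe.PiC))
    -- [AbsTopI] Lem 4.5 (v) (F-0206)
    (A : CuspidalAlgorithm.{0}) (hA : A.RecoversCusps D.geom.pe.extXbar C.cuspidalDataXbar)
    (hA' : A.RecoversCusps D'.geom.pe.extXbar C'.cuspidalDataXbar) :
    D.geom.pe.CharacteristicNatureOfCoverings D'.geom.pe :=
  have hL := D.pe_modLCuspLaws_of_geomOriginIota O C
  have hL' := D'.pe_modLCuspLaws_of_geomOriginIota O' C'
  D.pe_characteristicNatureOfCoverings_of_geomOrigin_ex48_cuspGalois D' O.toGeomOrigin O'.toGeomOrigin C C' h𝒟 hEx M h33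
    hmemX hadmX hΔX hneX htfgX hmemX' hadmX' hΔX' hneX' htfgX' hS ePi eC hcomp ePi' eC' hcomp' hmemY hadmY hΔY hneY htfgY
    hmemY' hadmY' hΔY' hneY' htfgY' hSY fPi fC hcompY fPi' fC' hcompY' hL.inertia_ε1_image_order hL.inertia_images_inf_le
    hL.iota_neg hL'.inertia_ε1_image_order hL'.inertia_images_inf_le hL'.iota_neg
    (D.pe_not_inertia_ε0_le_piXarrow_of_geomOriginIota O C) (D'.pe_not_inertia_ε0_le_piXarrow_of_geomOriginIota O' C')
    A hA hA'

end InitialThetaData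

end Literature.IUT.HodgeTheaters

end
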